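import Literature.NumberTheory.GaloisRepresentations.IdeleLocalInvariantsRange
import HarnessLib

/-!
# The local invariants of the relative Brauer group `Br(E/F) = H²(Gal(E/F), Eˣ)` and the Hasse principle
# `Br(E/F) ↪ ⨁_v (1/n_v)ℤ/ℤ` (Tate, C–F VII §9.6; Albert–Brauer–Hasse–Noether for classes split by `E`)

Topic `NumberTheory/GaloisRepresentations`; namespace `Literature.NumberTheory.GaloisRepresentations.IdeleCohomology`,
continuing `IdeleLocalInvariantsRange.lean` (`invFamily : H²(G, J_E) →+ ∏_v ℚ/ℤ × ∏_{v∣∞} ℚ/ℤ`, injective, image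
`⨁_v (1/n_v)ℤ/ℤ`) and the tree's `Automorphic/IdeleGaloisRep.lean` (`principalRepHom : Eˣ ⟶ J_E`,
**`IdeleClassGroup.mono_H2_map_principalRepHom`**: `H²(G, Eˣ) → H²(G, J_E)` is a monomorphism, from `H¹(G, C_E) = 0`).
Definitions with bodies (`brauerToIdele`, `brauerLocalInv`, `brauerLocalInvInf`, `brauerInvFamily`) and theorems;
NO named fact, no `sorry`, no instance, no notation; number fields in `Type`.

Mathematics.  Tate, C–F VII §9.6 [held copy `book:editornd-algebraic-number-theory` p0225, Cor. of Thm. 9.1 and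
the sequel]: `H¹(G, C_L) = 0` makes `H²(G, Lˣ) → H²(G, J_L)` injective, and `H²(G, J_L) ≅ ⨁_v H²(G^v, (L^v)ˣ)`
(Cor. 7.4 (b)); hence a class of `H²(Gal(L/K), Lˣ)` — a central simple `K`-algebra split by `L` — is trivial iff all
its local invariants vanish (the Albert–Brauer–Hasse–Noether theorem for the layer `L/K`).  Here, at a finite Galois
layer `E/F` of number fields: the local invariants `inv_v(β) := inv_v(image of β in H²(G, J_E))` of
`β ∈ H²(Gal(E/F), Eˣ)`, `n_v · inv_v(β) = 0`, almost all vanish, and **`β = 0 ↔ ∀ v, inv_v(β) = 0`**.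

Not here: `∑_v inv_v(β) = 0` (the reciprocity law, Tate §9.6 second half / §10).

## What is formalised (`F E : Type` number fields, `E/F` Galois, `G = E ≃ₐ[F] E`)

* `brauerToIdele : H²(G, Eˣ) ⟶ H²(G, J_E)` (`H²` of `principalRepHom`), **`brauerToIdele_injective`**.
* `brauerLocalInv E v`, `brauerLocalInvInf E v : H²(G, Eˣ) →+ ℚ/ℤ`; `localDegree_nsmul_brauerLocalInv`,
  `infLocalDegree_nsmul_brauerLocalInvInf`, `finite_support_brauerLocalInv`.
* **`eq_zero_of_forall_brauerLocalInv_eq_zero`**, `eq_of_forall_brauerLocalInv_eq`, `brauerInvFamily`,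
  **`brauerInvFamily_injective`** (Hasse principle for `Br(E/F)`).

## References
* J. W. S. Cassels, A. Fröhlich (eds.), *Algebraic Number Theory* (1967), Ch. VII (Tate) §7.3 Cor. 7.4 (b), §9.6.
  [CasselsFrohlichANT1967]
* D. Harari, *Galois Cohomology and Class Field Theory*, Springer (2020), §14.2 (Brauer–Hasse–Noether). [Harari2020]
-/

noncomputable section

open NumberField NumberField.InfinitePlace IsDedekindDomain CategoryTheory CategoryTheory.Limits groupCohomology
open Literature.NumberTheory.Automorphic

namespace Literature.NumberTheory.GaloisRepresentations

namespace IdeleCohomology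

open Literature.Algebra.Homology SemiLocal

variable {F : Type} [Field F] [NumberField F] {E : Type} [Field E] [NumberField E] [Algebra F E] [IsGalois F E]

/-! ## §1. `Br(E/F) = H²(G, Eˣ) ↪ H²(G, J_E)` -/

variable (F E) in
/-- **`H²(Gal(E/F), Eˣ) ⟶ H²(Gal(E/F), J_E)`**, `H²` of the principal idèles `Eˣ → J_E`.
[cite: CasselsFrohlichANT1967, Ch. VII §9.6] -/
def brauerToIdele :
    groupCohomology (Rep.ofAlgebraAutOnUnits F E) 2 ⟶ groupCohomology (IdeleClassGroup.ideleRep F E) 2 :=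
  (groupCohomology.functor ℤ (E ≃ₐ[F] E) 2).map (IdeleClassGroup.principalRepHom F E)

omit [NumberField F] [IsGalois F E] in
/-- Unfolding: `brauerToIdele = H²(principalRepHom)`. [cite: CasselsFrohlichANT1967, Ch. VII §9.6] -/
theorem brauerToIdele_apply (β : groupCohomology (Rep.ofAlgebraAutOnUnits F E) 2) :
    brauerToIdele F E β =
      groupCohomology.map (MonoidHom.id (E ≃ₐ[F] E)) (IdeleClassGroup.principalRepHom F E) 2 β := rfl

/-- **`H²(Gal(E/F), Eˣ) → H²(Gal(E/F), J_E)` is injective** (`H¹(G, C_E) = 0`; the tree's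
`IdeleClassGroup.mono_H2_map_principalRepHom`). [cite: CasselsFrohlichANT1967, Ch. VII §9.6] -/
theorem brauerToIdele_injective : Function.Injective (brauerToIdele F E) :=
  (ModuleCat.mono_iff_injective _).1 (IdeleClassGroup.mono_H2_map_principalRepHom F E)

/-! ## §2. The local invariants of a relative Brauer class -/

variable (E) in
/-- **The local invariant `inv_v(β) ∈ ℚ/ℤ` of `β ∈ H²(Gal(E/F), Eˣ)` at a finite place `v`** (the invariant of its
image in `H²(G, J_E)`). [cite: CasselsFrohlichANT1967, Ch. VII §9.6] -/
def brauerLocalInv (v : HeightOneSpectrum (𝓞 F)) :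
    groupCohomology (Rep.ofAlgebraAutOnUnits F E) 2 →+ AddCircle (1 : ℚ) :=
  (localInv E v).comp (brauerToIdele F E).hom.toAddMonoidHom

variable (E) in
/-- **The local invariant `inv_v(β)` of `β ∈ H²(Gal(E/F), Eˣ)` at an infinite place `v`.**
[cite: CasselsFrohlichANT1967, Ch. VII §9.6] -/
def brauerLocalInvInf (v : InfinitePlace F) :
    groupCohomology (Rep.ofAlgebraAutOnUnits F E) 2 →+ AddCircle (1 : ℚ) :=
  (localInvInf E v).comp (brauerToIdele F E).hom.toAddMonoidHom

/-- Unfolding. [cite: CasselsFrohlichANT1967, Ch. VII §9.6] -/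
theorem brauerLocalInv_apply (v : HeightOneSpectrum (𝓞 F)) (β : groupCohomology (Rep.ofAlgebraAutOnUnits F E) 2) :
    brauerLocalInv E v β = localInv E v (brauerToIdele F E β) := rfl

/-- Unfolding. [cite: CasselsFrohlichANT1967, Ch. VII §9.6] -/
theorem brauerLocalInvInf_apply (v : InfinitePlace F) (β : groupCohomology (Rep.ofAlgebraAutOnUnits F E) 2) :
    brauerLocalInvInf E v β = localInvInf E v (brauerToIdele F E β) := rfl

/-- `n_v · inv_v(β) = 0`. [cite: CasselsFrohlichANT1967, Ch. VII §9.6] -/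
theorem localDegree_nsmul_brauerLocalInv (v : HeightOneSpectrum (𝓞 F))
    (β : groupCohomology (Rep.ofAlgebraAutOnUnits F E) 2) : localDegree E v • brauerLocalInv E v β = 0 := by
  rw [brauerLocalInv_apply]
  exact localDegree_nsmul_localInv v (brauerToIdele F E β)

/-- `n_v · inv_v(β) = 0` at an infinite place. [cite: CasselsFrohlichANT1967, Ch. VII §9.6] -/
theorem infLocalDegree_nsmul_brauerLocalInvInf (v : InfinitePlace F)
    (β : groupCohomology (Rep.ofAlgebraAutOnUnits F E) 2) : infLocalDegree E v • brauerLocalInvInf E v β = 0 := by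
  rw [brauerLocalInvInf_apply]
  exact infLocalDegree_nsmul_localInvInf v (brauerToIdele F E β)

/-- **Almost all local invariants of a relative Brauer class vanish.** [cite: CasselsFrohlichANT1967, Ch. VII §9.6] -/
theorem finite_support_brauerLocalInv (β : groupCohomology (Rep.ofAlgebraAutOnUnits F E) 2) :
    (Function.support fun v : HeightOneSpectrum (𝓞 F) => brauerLocalInv E v β).Finite := by
  have h := finite_support_localInv (brauerToIdele F E β)
  refine h.subset fun v hv => ?_
  rwa [Function.mem_support, brauerLocalInv_apply] at hv

/-! ## §3. The Hasse principle for `Br(E/F)` -/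

/-- **Albert–Brauer–Hasse–Noether for the layer `E/F`: a class of `H²(Gal(E/F), Eˣ)` all of whose local invariants
vanish is zero** (`H²(G, Eˣ) ↪ H²(G, J_E)` and a class of `H²(G, J_E)` is determined by its invariants).
[cite: CasselsFrohlichANT1967, Ch. VII §9.6][cite: Harari2020, §14.2] -/
theorem eq_zero_of_forall_brauerLocalInv_eq_zero (β : groupCohomology (Rep.ofAlgebraAutOnUnits F E) 2)
    (hfin : ∀ v : HeightOneSpectrum (𝓞 F), brauerLocalInv E v β = 0)
    (hinf : ∀ v : InfinitePlace F, brauerLocalInvInf E v β = 0) : β = 0 := by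
  refine (injective_iff_map_eq_zero _).1 brauerToIdele_injective β
    (eq_zero_of_forall_localInv_eq_zero' (brauerToIdele F E β) (fun v => ?_) (fun v => ?_))
  · rw [← brauerLocalInv_apply]
    exact hfin v
  · rw [← brauerLocalInvInf_apply]
    exact hinf v

/-- Two relative Brauer classes with the same local invariants are equal. [cite: CasselsFrohlichANT1967, Ch. VII §9.6] -/
theorem eq_of_forall_brauerLocalInv_eq (β β' : groupCohomology (Rep.ofAlgebraAutOnUnits F E) 2)
    (hfin : ∀ v : HeightOneSpectrum (𝓞 F), brauerLocalInv E v β = brauerLocalInv E v β')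
    (hinf : ∀ v : InfinitePlace F, brauerLocalInvInf E v β = brauerLocalInvInf E v β') : β = β' := by
  refine brauerToIdele_injective (eq_of_forall_localInv_eq (brauerToIdele F E β) (brauerToIdele F E β')
    (fun v => ?_) (fun v => ?_))
  · rw [← brauerLocalInv_apply, ← brauerLocalInv_apply]
    exact hfin v
  · rw [← brauerLocalInvInf_apply, ← brauerLocalInvInf_apply]
    exact hinf v

variable (F E) in
/-- **The family of local invariants of a relative Brauer class**, `H²(Gal(E/F), Eˣ) →+ (∏_v ℚ/ℤ) × (∏_{v∣∞} ℚ/ℤ)`.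
[cite: CasselsFrohlichANT1967, Ch. VII §9.6] -/
def brauerInvFamily : groupCohomology (Rep.ofAlgebraAutOnUnits F E) 2 →+
    (HeightOneSpectrum (𝓞 F) → AddCircle (1 : ℚ)) × (InfinitePlace F → AddCircle (1 : ℚ)) :=
  (invFamily F E).comp (brauerToIdele F E).hom.toAddMonoidHom

/-- Components of `brauerInvFamily`. [cite: CasselsFrohlichANT1967, Ch. VII §9.6] -/
theorem brauerInvFamily_apply (β : groupCohomology (Rep.ofAlgebraAutOnUnits F E) 2) :
    brauerInvFamily F E β = (fun v => brauerLocalInv E v β, fun v => brauerLocalInvInf E v β) := rfl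

/-- **The Hasse principle: `Br(E/F) = H²(Gal(E/F), Eˣ) → ∏_v ℚ/ℤ` is injective.**
[cite: CasselsFrohlichANT1967, Ch. VII §9.6][cite: Harari2020, §14.2] -/
theorem brauerInvFamily_injective : Function.Injective (brauerInvFamily F E) := by
  rw [brauerInvFamily, AddMonoidHom.coe_comp]
  exact invFamily_injective.comp brauerToIdele_injective

/-- The image of `brauerInvFamily` lies in the finitely supported torsion families `⨁_v (1/n_v)ℤ/ℤ`.
[cite: CasselsFrohlichANT1967, Ch. VII §9.6] -/
theorem range_brauerInvFamily_subset :
    Set.range (brauerInvFamily F E) ⊆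
      {p | (Function.support p.1).Finite ∧ (∀ v, localDegree E v • p.1 v = 0) ∧
        ∀ v, infLocalDegree E v • p.2 v = 0} := by
  rintro _ ⟨β, rfl⟩
  rw [← range_invFamily, brauerInvFamily, AddMonoidHom.coe_comp]
  exact ⟨brauerToIdele F E β, rfl⟩

end IdeleCohomology

end Literature.NumberTheory.GaloisRepresentations

end
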